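import Summits.QuantumFields.YangMills.Theorems.UnitScaleTiltProp7CovWeightedRowMemberAllScales
import Summits.QuantumFields.YangMills.Theorems.UnitScaleTiltProp7LinearCorrectorClose
import HarnessLib

/-!
# Route `UnitScaleTilt`, crux K1 «MinimiserStabilityRegPr» (stmt-QuantumFields-19200), route-R E′ path (α′), (E1-b) — THE CLOSE, (hK₂-cov) HALF DISCHARGED: the door row `hL` of the exact-corrector contraction at every
# `RegPr` member from ONE displayed row `hKsup` (the covariant (hK) in routeR-w6's hs-currency), the weight row `hK₂sup` being px11 g3's ✓p680458 `weight_row_member_all_scales` (every scale, small-ℓ branch included)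

Cell `ym3-torus`, D-0154 (3c) twin-width seat `ym-routeR-w3` (gen 6) = namer of the (hK)∕(A)∕(E1-b) lineage.  ✓p675883 `Prop7LinearCorrectorClose.linCorr_gauge_le_of_supplier_rows` ∘ ✓p680458; member letters = px4 g3's
(`F := ⟨ℓ+1, hL, m, hm⟩`, `W : GaugeField (PV 2 ℓ m K hd3 hL) 0 SU(2)`, `RegPr F n K α₀ W`, window row).  THEOREMS ONLY (0 `def`, 0 `sorry`); `--supports stmt-QuantumFields-19200`, count-neutral.  YM₃ on T³ is a ladder rung (R3),
not the Clay problem; nothing here claims the stub, the crux, d = 4 or the gap.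

WHAT IS PROVED (ns `…Theorems.Prop7LinearCorrectorCloseHK2`): ★★★ `linCorr_gauge_le_of_hKsup` — `∃ c35 a₅ C₂ > 0, ∀ (member data, RegPr, window) (w p q κ) (hKsup at W), ∃ I L, (L A = φ − Iφ) ∧ (pinned) ∧
∀ A, p (L A) ≤ max (3∕2·(κ√2∕ℓ_k)) (max (κ√2∕ℓ_k) C₂) · q A`.
HONEST SCOPE.  `hKsup` DISPLAYED (supplier: px22 g3's (A-cov) member theorem over the transplant, gen-1 numbers pending); everything else ✓.

References: T. Bałaban, CMP 102 (1985) 277–309 [Balaban1985Variational] (Prop. 7 p.299); CMP 99 (1985) 75–102 [Balaban1985RegularSpaces] ((1.36) p.82); CMP 99 (1985) 389–434 [Balaban1985BackgroundPropagators] ((3.8) p.392).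
-/

set_option autoImplicit false

noncomputable section

open scoped BigOperators Matrix.Norms.L2Operator Matrix

namespace Summit.QuantumFields.YangMills.Theorems.Prop7LinearCorrectorCloseHK2

open Literature.MathematicalPhysics.QuantumFieldTheory.Balaban1983to89
open Literature.MathematicalPhysics.QuantumFieldTheory.Balaban1983to89.T3ContinuumYM3Torus
open Literature.MathematicalPhysics.QuantumFieldTheory.Balaban1983to89.T3PrintedRegularMinimiser (RegPr)
open Literature.MathematicalPhysics.QuantumFieldTheory.Balaban1983to89.B6GlobalChartV1 (PV)
open B9Eq39Adjoint (covD divB)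
open B9TorusCalculus (torusT)
open B10Eq27TorusAxialLog (unitsField toUField)
open B15DeterminingSets (embIter)
open Summit.QuantumFields.YangMills.Theorems.Prop7SectET3Members (hd3)
open Summit.QuantumFields.YangMills.Theorems.Prop7CovWeightedRowMemberAllScales (weight_row_member_all_scales)
open Summit.QuantumFields.YangMills.Theorems.Prop7LinearCorrectorClose (linCorr_gauge_le_of_supplier_rows)

variable {ℓ : ℕ} {hL : Odd (ℓ + 1) ∧ 1 < ℓ + 1}

/-- ★★★ **(E1-b) CLOSE WITH (hK₂-cov) DISCHARGED.**  At every `RegPr` member (px4 g3's standing data and window row), for every admissible weight `w`, gauge `p` of the knit's shape (`T₂ := T₂ʷ`), size `q` dominating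
`ℓ_k²‖D*_𝒰A‖_∞` and constant `κ ≥ 0`: IF the covariant (hK) row `hKsup` holds at `W` (hs-currency, every pinned-biharmonic interpolant, every `s₁`), THEN px13's `I, L` satisfy `∀ A, p (L A) ≤ max (3∕2·(κ√2∕ℓ_k)) (max (κ√2∕ℓ_k) C₂)·q A`
— the weight row being ✓ `weight_row_member_all_scales`. [cite: Balaban1985Variational, Prop. 7 p.299; Balaban1985RegularSpaces, (1.36) p.82; Balaban1985BackgroundPropagators, (3.8) p.392] -/
theorem linCorr_gauge_le_of_hKsup (hℓ4 : 4 ≤ ℓ) : ∃ c35 a₅ C₂ : ℝ, 0 < c35 ∧ 0 < a₅ ∧ 0 < C₂ ∧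
    ∀ (hℓ : 4 ≤ ℓ) (m : ℕ) (hm : 1 ≤ m) (n K a' R : ℕ) (hk1 : 1 ≤ K - n) (hsize : a' + 3 ≤ m + n) (hM8 : 8 ≤ (ℓ + 1) ^ a')
      (hR2 : 2 * (ℓ + 1) ^ 2 ≤ R) (α₀ : ℝ), 0 < α₀ → α₀ ≤ 1 → ((ℓ + 1 : ℕ) : ℝ) * (((ℓ + 1) ^ a' : ℕ) : ℝ) * α₀ ≤ a₅ →
      ∀ W : GaugeField (PV 2 ℓ m K hd3 hL) 0 (Matrix.specialUnitaryGroup (Fin 2) ℂ),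
        RegPr (⟨ℓ + 1, hL, m, hm⟩ : T3Family) n K α₀ W →
        (4 * 2197 * (24 * 289 * 24576 * 46116) : ℝ) * ((2 : ℕ) : ℝ) ^ 2 * ((((PV 2 ℓ m K hd3 hL).L : ℝ)) ^ (K - n)) ^ 4
            * ((((PV 2 ℓ m K hd3 hL).d : ℝ)) ^ 2 * (4 * ((2 : ℕ) : ℝ) * (α₀ * ((((PV 2 ℓ m K hd3 hL).L : ℝ))⁻¹) ^ (2 * (K - n))) ^ 2
              + (2 * ((((ℓ + 1 : ℕ) : ℝ) ^ (K - n))⁻¹ * ((((ℓ + 1 : ℕ) : ℝ) ^ (K - n))⁻¹ * (c35 * (((ℓ + 1 : ℕ) : ℝ) * (((ℓ + 1) ^ a' : ℕ) : ℝ)) * α₀))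
                  * Real.exp ((((ℓ + 1 : ℕ) : ℝ) ^ (K - n))⁻¹ * (c35 * (((ℓ + 1 : ℕ) : ℝ) * (((ℓ + 1) ^ a' : ℕ) : ℝ)) * α₀)))
                + 4 * ((((ℓ + 1 : ℕ) : ℝ) ^ (K - n))⁻¹ * (c35 * (((ℓ + 1 : ℕ) : ℝ) * (((ℓ + 1) ^ a' : ℕ) : ℝ)) * α₀)
                  * Real.exp ((((ℓ + 1 : ℕ) : ℝ) ^ (K - n))⁻¹ * (c35 * (((ℓ + 1 : ℕ) : ℝ) * (((ℓ + 1) ^ a' : ℕ) : ℝ)) * α₀))) ^ 2) ^ 2)) ≤ 1 / 4 →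
        ∀ (w : Site (PV 2 ℓ m K hd3 hL) 0 → ℝ), (∀ (x : Site (PV 2 ℓ m K hd3 hL) 0) (y : Site (PV 2 ℓ m K hd3 hL) (K - n)), w x ≤ (Site.tdist x (embIter (K - n) y) : ℝ)) →
          (∀ x, w x ≤ (((⟨ℓ + 1, hL, m, hm⟩ : T3Family).L : ℕ) : ℝ) ^ (K - n)) → (∀ x, 0 ≤ w x) →
        ∀ (p : (Site (PV 2 ℓ m K hd3 hL) 0 → Matrix (Fin 2) (Fin 2) ℂ) → ℝ),
          (∀ ψ, p ψ = max ‖ψ‖ (max ((((⟨ℓ + 1, hL, m, hm⟩ : T3Family).L : ℕ) : ℝ) ^ (K - n) * ‖(fun μ z => covD (torusT (PV 2 ℓ m K hd3 hL) 0) (fun κ z => unitsField (toUField W) ⟨z, κ⟩) μ ψ z)‖)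
            ((((⟨ℓ + 1, hL, m, hm⟩ : T3Family).L : ℕ) : ℝ) ^ (K - n) * ‖(fun x => ((w x : ℝ) : ℂ) • divB (torusT (PV 2 ℓ m K hd3 hL) 0) (fun κ z => unitsField (toUField W) ⟨z, κ⟩) (fun μ => covD (torusT (PV 2 ℓ m K hd3 hL) 0) (fun κ z => unitsField (toUField W) ⟨z, κ⟩) μ ψ) x)‖))) →
        ∀ (q : (Fin (PV 2 ℓ m K hd3 hL).d → Site (PV 2 ℓ m K hd3 hL) 0 → Matrix (Fin 2) (Fin 2) ℂ) → ℝ),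
          (∀ A, ((((⟨ℓ + 1, hL, m, hm⟩ : T3Family).L : ℕ) : ℝ) ^ (K - n)) ^ 2 * ‖(fun x => divB (torusT (PV 2 ℓ m K hd3 hL) 0) (fun κ z => unitsField (toUField W) ⟨z, κ⟩) A x)‖ ≤ q A) →
        ∀ (κ : ℝ), 0 ≤ κ →
        (∀ (φ φH : Site (PV 2 ℓ m K hd3 hL) 0 → Matrix (Fin 2) (Fin 2) ℂ),
          (∀ y : Site (PV 2 ℓ m K hd3 hL) (K - n), φH (embIter (K - n) y) = φ (embIter (K - n) y)) →
          (∀ x : Site (PV 2 ℓ m K hd3 hL) 0, x ∉ Set.range (embIter (K - n)) → divB (torusT (PV 2 ℓ m K hd3 hL) 0) (fun κ z => unitsField (toUField W) ⟨z, κ⟩) (fun μ => covD (torusT (PV 2 ℓ m K hd3 hL) 0) (fun κ z => unitsField (toUField W) ⟨z, κ⟩) μ (fun y => divB (torusT (PV 2 ℓ m K hd3 hL) 0) (fun κ z => unitsField (toUField W) ⟨z, κ⟩) (fun μ => covD (torusT (PV 2 ℓ m K hd3 hL) 0) (fun κ z => unitsField (toUField W) ⟨z, κ⟩) μ φH) y))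 x = 0) →
          ∀ s₁ : ℝ, (∀ z, Real.sqrt (∑ j : Fin 2, ∑ k : Fin 2, ‖(divB (torusT (PV 2 ℓ m K hd3 hL) 0) (fun κ z => unitsField (toUField W) ⟨z, κ⟩) (fun μ => covD (torusT (PV 2 ℓ m K hd3 hL) 0) (fun κ z => unitsField (toUField W) ⟨z, κ⟩) μ φ) z) j k‖ ^ 2) ≤ s₁) →
          ∀ (μ : Fin (PV 2 ℓ m K hd3 hL).d) (x : Site (PV 2 ℓ m K hd3 hL) 0),
            Real.sqrt (∑ j : Fin 2, ∑ k : Fin 2, ‖(covD (torusT (PV 2 ℓ m K hd3 hL) 0) (fun κ z => unitsField (toUField W) ⟨z, κ⟩) μ (fun y => φ y - φH y) x) j k‖ ^ 2) ≤ κ * s₁) →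
        ∃ (I : (Site (PV 2 ℓ m K hd3 hL) 0 → Matrix (Fin 2) (Fin 2) ℂ) →+ (Site (PV 2 ℓ m K hd3 hL) 0 → Matrix (Fin 2) (Fin 2) ℂ))
          (L : (Fin (PV 2 ℓ m K hd3 hL).d → Site (PV 2 ℓ m K hd3 hL) 0 → Matrix (Fin 2) (Fin 2) ℂ) →+ (Site (PV 2 ℓ m K hd3 hL) 0 → Matrix (Fin 2) (Fin 2) ℂ)),
          (∀ A φ, (∀ x, divB (torusT (PV 2 ℓ m K hd3 hL) 0) (fun κ z => unitsField (toUField W) ⟨z, κ⟩) (fun μ => covD (torusT (PV 2 ℓ m K hd3 hL) 0) (fun κ z => unitsField (toUField W) ⟨z, κ⟩) μ φ) x = divB (torusT (PV 2 ℓ m K hd3 hL) 0) (fun κ z => unitsField (toUField W) ⟨z, κ⟩) A x) → L A = φ - I φ) ∧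
          (∀ (A) (y : Site (PV 2 ℓ m K hd3 hL) (K - n)), L A (embIter (K - n) y) = 0) ∧
          ∀ A, p (L A) ≤ max (3 / 2 * (κ * Real.sqrt 2 / (((⟨ℓ + 1, hL, m, hm⟩ : T3Family).L : ℕ) : ℝ) ^ (K - n))) (max (κ * Real.sqrt 2 / (((⟨ℓ + 1, hL, m, hm⟩ : T3Family).L : ℕ) : ℝ) ^ (K - n)) C₂) * q A := by
  obtain ⟨c35, a₅, C₂, hc35, ha₅, hC₂, H⟩ := weight_row_member_all_scales (hL := hL) hℓ4
  refine ⟨c35, a₅, C₂, hc35, ha₅, hC₂, ?_⟩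
  intro hℓ m hm n K a' R hk1 hsize hM8 hR2 α₀ hα₀ hα1 hMα W hreg hwin w hwC hwℓ hw0 p hp q hq κ hκ hKsup
  have hK₂sup := H hℓ m hm n K a' R hk1 hsize hM8 hR2 α₀ hα₀ hα1 hMα W hreg hwin
  exact linCorr_gauge_le_of_supplier_rows (⟨ℓ + 1, hL, m, hm⟩ : T3Family) K n W w hwC hwℓ hw0 p hp q hq hκ hC₂.le hKsup hK₂sup

/-- ★★★ **(E1-b) CLOSE WITH (hK₂-cov) DISCHARGED, CHARACTERISATION EXPORTED** (v1.1, ym3-torus-px13 g4 for the (E1)-door ✓ `Prop7PinnedSliceRowOfThm2Datum`): ✓ `linCorr_gauge_le_of_hKsup` VERBATIM whose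
conclusion ALSO exports the (I)-characterisation and solvability (✓ `linCorr_gauge_le_of_supplier_rows_char`) — the shape the (E1)-door's socket `hLrow` reads.
[cite: Balaban1985Variational, Prop. 7 p.299; Balaban1985RegularSpaces, (1.36) p.82; Balaban1985BackgroundPropagators, (3.8) p.392] -/
theorem linCorr_gauge_le_of_hKsup_char (hℓ4 : 4 ≤ ℓ) : ∃ c35 a₅ C₂ : ℝ, 0 < c35 ∧ 0 < a₅ ∧ 0 < C₂ ∧
    ∀ (hℓ : 4 ≤ ℓ) (m : ℕ) (hm : 1 ≤ m) (n K a' R : ℕ) (hk1 : 1 ≤ K - n) (hsize : a' + 3 ≤ m + n) (hM8 : 8 ≤ (ℓ + 1) ^ a')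
      (hR2 : 2 * (ℓ + 1) ^ 2 ≤ R) (α₀ : ℝ), 0 < α₀ → α₀ ≤ 1 → ((ℓ + 1 : ℕ) : ℝ) * (((ℓ + 1) ^ a' : ℕ) : ℝ) * α₀ ≤ a₅ →
      ∀ W : GaugeField (PV 2 ℓ m K hd3 hL) 0 (Matrix.specialUnitaryGroup (Fin 2) ℂ),
        RegPr (⟨ℓ + 1, hL, m, hm⟩ : T3Family) n K α₀ W →
        (4 * 2197 * (24 * 289 * 24576 * 46116) : ℝ) * ((2 : ℕ) : ℝ) ^ 2 * ((((PV 2 ℓ m K hd3 hL).L : ℝ)) ^ (K - n)) ^ 4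
            * ((((PV 2 ℓ m K hd3 hL).d : ℝ)) ^ 2 * (4 * ((2 : ℕ) : ℝ) * (α₀ * ((((PV 2 ℓ m K hd3 hL).L : ℝ))⁻¹) ^ (2 * (K - n))) ^ 2
              + (2 * ((((ℓ + 1 : ℕ) : ℝ) ^ (K - n))⁻¹ * ((((ℓ + 1 : ℕ) : ℝ) ^ (K - n))⁻¹ * (c35 * (((ℓ + 1 : ℕ) : ℝ) * (((ℓ + 1) ^ a' : ℕ) : ℝ)) * α₀))
                  * Real.exp ((((ℓ + 1 : ℕ) : ℝ) ^ (K - n))⁻¹ * (c35 * (((ℓ + 1 : ℕ) : ℝ) * (((ℓ + 1) ^ a' : ℕ) : ℝ)) * α₀)))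
                + 4 * ((((ℓ + 1 : ℕ) : ℝ) ^ (K - n))⁻¹ * (c35 * (((ℓ + 1 : ℕ) : ℝ) * (((ℓ + 1) ^ a' : ℕ) : ℝ)) * α₀)
                  * Real.exp ((((ℓ + 1 : ℕ) : ℝ) ^ (K - n))⁻¹ * (c35 * (((ℓ + 1 : ℕ) : ℝ) * (((ℓ + 1) ^ a' : ℕ) : ℝ)) * α₀))) ^ 2) ^ 2)) ≤ 1 / 4 →
        ∀ (w : Site (PV 2 ℓ m K hd3 hL) 0 → ℝ), (∀ (x : Site (PV 2 ℓ m K hd3 hL) 0) (y : Site (PV 2 ℓ m K hd3 hL) (K - n)), w x ≤ (Site.tdist x (embIter (K - n) y) : ℝ)) →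
          (∀ x, w x ≤ (((⟨ℓ + 1, hL, m, hm⟩ : T3Family).L : ℕ) : ℝ) ^ (K - n)) → (∀ x, 0 ≤ w x) →
        ∀ (p : (Site (PV 2 ℓ m K hd3 hL) 0 → Matrix (Fin 2) (Fin 2) ℂ) → ℝ),
          (∀ ψ, p ψ = max ‖ψ‖ (max ((((⟨ℓ + 1, hL, m, hm⟩ : T3Family).L : ℕ) : ℝ) ^ (K - n) * ‖(fun μ z => covD (torusT (PV 2 ℓ m K hd3 hL) 0) (fun κ z => unitsField (toUField W) ⟨z, κ⟩) μ ψ z)‖)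
            ((((⟨ℓ + 1, hL, m, hm⟩ : T3Family).L : ℕ) : ℝ) ^ (K - n) * ‖(fun x => ((w x : ℝ) : ℂ) • divB (torusT (PV 2 ℓ m K hd3 hL) 0) (fun κ z => unitsField (toUField W) ⟨z, κ⟩) (fun μ => covD (torusT (PV 2 ℓ m K hd3 hL) 0) (fun κ z => unitsField (toUField W) ⟨z, κ⟩) μ ψ) x)‖))) →
        ∀ (q : (Fin (PV 2 ℓ m K hd3 hL).d → Site (PV 2 ℓ m K hd3 hL) 0 → Matrix (Fin 2) (Fin 2) ℂ) → ℝ),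
          (∀ A, ((((⟨ℓ + 1, hL, m, hm⟩ : T3Family).L : ℕ) : ℝ) ^ (K - n)) ^ 2 * ‖(fun x => divB (torusT (PV 2 ℓ m K hd3 hL) 0) (fun κ z => unitsField (toUField W) ⟨z, κ⟩) A x)‖ ≤ q A) →
        ∀ (κ : ℝ), 0 ≤ κ →
        (∀ (φ φH : Site (PV 2 ℓ m K hd3 hL) 0 → Matrix (Fin 2) (Fin 2) ℂ),
          (∀ y : Site (PV 2 ℓ m K hd3 hL) (K - n), φH (embIter (K - n) y) = φ (embIter (K - n) y)) →
          (∀ x : Site (PV 2 ℓ m K hd3 hL) 0, x ∉ Set.range (embIter (K - n)) → divB (torusT (PV 2 ℓ m K hd3 hL) 0) (fun κ z => unitsField (toUField W) ⟨z, κ⟩) (fun μ => covD (torusT (PV 2 ℓ m K hd3 hL) 0) (fun κ z => unitsField (toUField W) ⟨z, κ⟩) μ (fun y => divB (torusT (PV 2 ℓ m K hd3 hL) 0) (fun κ z => unitsField (toUField W) ⟨z, κ⟩) (fun μ => covD (torusT (PV 2 ℓ m K hd3 hL) 0) (fun κ z => unitsField (toUField W) ⟨z, κ⟩) μ φH) y))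 x = 0) →
          ∀ s₁ : ℝ, (∀ z, Real.sqrt (∑ j : Fin 2, ∑ k : Fin 2, ‖(divB (torusT (PV 2 ℓ m K hd3 hL) 0) (fun κ z => unitsField (toUField W) ⟨z, κ⟩) (fun μ => covD (torusT (PV 2 ℓ m K hd3 hL) 0) (fun κ z => unitsField (toUField W) ⟨z, κ⟩) μ φ) z) j k‖ ^ 2) ≤ s₁) →
          ∀ (μ : Fin (PV 2 ℓ m K hd3 hL).d) (x : Site (PV 2 ℓ m K hd3 hL) 0),
            Real.sqrt (∑ j : Fin 2, ∑ k : Fin 2, ‖(covD (torusT (PV 2 ℓ m K hd3 hL) 0) (fun κ z => unitsField (toUField W) ⟨z, κ⟩) μ (fun y => φ y - φH y) x) j k‖ ^ 2) ≤ κ * s₁) →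
        ∃ (I : (Site (PV 2 ℓ m K hd3 hL) 0 → Matrix (Fin 2) (Fin 2) ℂ) →+ (Site (PV 2 ℓ m K hd3 hL) 0 → Matrix (Fin 2) (Fin 2) ℂ))
          (L : (Fin (PV 2 ℓ m K hd3 hL).d → Site (PV 2 ℓ m K hd3 hL) 0 → Matrix (Fin 2) (Fin 2) ℂ) →+ (Site (PV 2 ℓ m K hd3 hL) 0 → Matrix (Fin 2) (Fin 2) ℂ)),
          -- (I) the pinned `Δ_W`-biharmonic interpolant, characterised (✓ `exists_linCorr_member`'s export)
          (∀ φ, ((∀ y : Site (PV 2 ℓ m K hd3 hL) (K - n), I φ (embIter (K - n) y) = φ (embIter (K - n) y)) ∧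
              ∀ x : Site (PV 2 ℓ m K hd3 hL) 0, x ∉ Set.range (embIter (K - n)) →
                divB (torusT (PV 2 ℓ m K hd3 hL) 0) (fun κ z => unitsField (toUField W) ⟨z, κ⟩) (fun μ => covD (torusT (PV 2 ℓ m K hd3 hL) 0) (fun κ z => unitsField (toUField W) ⟨z, κ⟩) μ (fun y => divB (torusT (PV 2 ℓ m K hd3 hL) 0) (fun κ z => unitsField (toUField W) ⟨z, κ⟩) (fun ν => covD (torusT (PV 2 ℓ m K hd3 hL) 0) (fun κ z => unitsField (toUField W) ⟨z, κ⟩) ν (I φ)) y)) x = 0) ∧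
            ∀ χ, (∀ y : Site (PV 2 ℓ m K hd3 hL) (K - n), χ (embIter (K - n) y) = φ (embIter (K - n) y)) →
              (∀ x : Site (PV 2 ℓ m K hd3 hL) 0, x ∉ Set.range (embIter (K - n)) →
                divB (torusT (PV 2 ℓ m K hd3 hL) 0) (fun κ z => unitsField (toUField W) ⟨z, κ⟩) (fun μ => covD (torusT (PV 2 ℓ m K hd3 hL) 0) (fun κ z => unitsField (toUField W) ⟨z, κ⟩) μ (fun y => divB (torusT (PV 2 ℓ m K hd3 hL) 0) (fun κ z => unitsField (toUField W) ⟨z, κ⟩) (fun ν => covD (torusT (PV 2 ℓ m K hd3 hL) 0) (fun κ z => unitsField (toUField W) ⟨z, κ⟩) ν χ) y)) x = 0) → χ = I φ) ∧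
          -- (L) the corrector for every potential
          (∀ A φ, (∀ x, divB (torusT (PV 2 ℓ m K hd3 hL) 0) (fun κ z => unitsField (toUField W) ⟨z, κ⟩) (fun μ => covD (torusT (PV 2 ℓ m K hd3 hL) 0) (fun κ z => unitsField (toUField W) ⟨z, κ⟩) μ φ) x = divB (torusT (PV 2 ℓ m K hd3 hL) 0) (fun κ z => unitsField (toUField W) ⟨z, κ⟩) A x) → L A = φ - I φ) ∧
          -- pinning
          (∀ (A) (y : Site (PV 2 ℓ m K hd3 hL) (K - n)), L A (embIter (K - n) y) = 0) ∧
          -- solvability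
          (∀ A, ∃ φ, (∀ x, divB (torusT (PV 2 ℓ m K hd3 hL) 0) (fun κ z => unitsField (toUField W) ⟨z, κ⟩) (fun μ => covD (torusT (PV 2 ℓ m K hd3 hL) 0) (fun κ z => unitsField (toUField W) ⟨z, κ⟩) μ φ) x = divB (torusT (PV 2 ℓ m K hd3 hL) 0) (fun κ z => unitsField (toUField W) ⟨z, κ⟩) A x) ∧ L A = φ - I φ) ∧
          ∀ A, p (L A) ≤ max (3 / 2 * (κ * Real.sqrt 2 / (((⟨ℓ + 1, hL, m, hm⟩ : T3Family).L : ℕ) : ℝ) ^ (K - n))) (max (κ * Real.sqrt 2 / (((⟨ℓ + 1, hL, m, hm⟩ : T3Family).L : ℕ) : ℝ) ^ (K - n)) C₂) * q A := by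
  obtain ⟨c35, a₅, C₂, hc35, ha₅, hC₂, H⟩ := weight_row_member_all_scales (hL := hL) hℓ4
  refine ⟨c35, a₅, C₂, hc35, ha₅, hC₂, ?_⟩
  intro hℓ m hm n K a' R hk1 hsize hM8 hR2 α₀ hα₀ hα1 hMα W hreg hwin w hwC hwℓ hw0 p hp q hq κ hκ hKsup
  have hK₂sup := H hℓ m hm n K a' R hk1 hsize hM8 hR2 α₀ hα₀ hα1 hMα W hreg hwin
  exact Prop7LinearCorrectorClose.linCorr_gauge_le_of_supplier_rows_char (⟨ℓ + 1, hL, m, hm⟩ : T3Family) K n W w hwC hwℓ hw0 p hp q hq hκ hC₂.le hKsup hK₂sup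

end Summit.QuantumFields.YangMills.Theorems.Prop7LinearCorrectorCloseHK2

end
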